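import Summits.CriticalPhenomena.PercolationContinuityZ3.Theorems.PercNearOneGluingNoHeavyLowerTailSahiTangentCylinderPairsOneCube

/-!
# `NoHeavyLowerTail` (crux stmt-CriticalPhenomena-4575), Sahi programme: **SINGLE-COORDINATE CONTRACTION ON SAHI'S WHOLE CUMULATION CONE, EVERY ORDER**
# — for `f_0,…,f_{n−1} ∈ 𝒞` (nonnegative combinations of cylinder indicators) and any coordinate `e`:
# `q_e · E_n(f_0^e,…,f_{n−1}^e) ≤ E_n(f_0,…,f_{n−1})`, `f^e(ω) := f(ω ∪ {e})` — i.e. `E_n(f) ≥ P(e open)·E_n(f | e open)`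

Support file (Sahi cell, seat `prim-sahi-p1`, generation 50; `--supports stmt-CriticalPhenomena-4575`).  Pure proofs, NO definitions, no `sorry`,
standard axioms.

THE RESULT (`sahiE_cumulation_edge_ge`).  `μ = bernoulliWeight q` on the cube `Set ι`.  A slot of Sahi's cumulation cone `𝒞[ι]` [Sahi 2008, eq. (1)] is
written explicitly as `f(ω) = Σ_σ c(σ)·1_{σ ⊆ ω}` with `c ≥ 0` (`Finset ι`-indexed coefficients); its section at "`e` open" is
`f^e(ω) = f(ω ∪ {e}) = Σ_σ c(σ)·1_{σ∖{e} ⊆ ω}` — in Sahi's notation `ρ⁺_e f`, again in `𝒞`.  THEOREM: for every `n` and all such `f_0,…,f_{n−1}`,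
`q_e · E_n^{μ}(f_0^e,…,f_{n−1}^e) ≤ E_n^{μ}(f_0,…,f_{n−1})`.  Since `μ(· | e open)` is the same product measure with `ω ∪ {e} = ω` a.s., this is the
tangent / contraction inequality `E_n(f) ≥ P(e)·E_n(f | e open)` ("Conjecture T_n", memo FROM-prim-sahi-p2-gen32-TANGENT) for the ENTIRE class on which
Sahi's positivity theorem [Sahi 2008, Thm. 2] is stated, at every order.  Sahi proves `E_n ≥ 0` on `𝒞`; this quantitative refinement is not in print
(presearch: none).  PROOF: `E_n` is linear in each slot (`sahiE_update_lin`); expanding the cumulation slots one at a time reduces the claim to families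
of single cylinders `1_{C(τ_l)}`, where it is Theorem V read on one cube (`sahiE_cylinders_edge_ge`: `q_e·E_n(C(τ_l∖e)) ≤ E_n(C(τ_l))`).
COROLLARY (`sahiE_cumulation_edges_ge`): for a finite set `D` of coordinates, `(∏_{e∈D} q_e)·E_n(f^D) ≤ E_n(f)`, `f^D(ω) = f(ω ∪ D)`.
Nothing conjectural is asserted. [this work]
-/

namespace Summit.CriticalPhenomena.PercolationContinuityZ3.Theorems.SahiTangentCyl

open Finset Function Literature.Combinatorics.Sahi2008
open Literature.Probability.Percolation.DecisionTree (ind ind_of_mem ind_of_not_mem ind_nonneg)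
open scoped BigOperators

noncomputable section

variable {α : Type*} [Fintype α]

/-- **`E_n` is linear in each slot: finite sums with coefficients.** [this work] -/
theorem sahiE_update_finset_sum {κ : Type*} (μ : α → ℝ) {n : ℕ} (f : Fin n → α → ℝ) (i : Fin n) (T : Finset κ) (a : κ → ℝ)
    (g : κ → α → ℝ) :
    sahiE μ n (update f i (fun x => ∑ σ ∈ T, a σ * g σ x)) = ∑ σ ∈ T, a σ * sahiE μ n (update f i (g σ)) := by
  classical
  induction T using Finset.induction_on with
  | empty =>
    simp only [Finset.sum_empty]
    exact sahiE_update_zero μ f i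
  | insert σ₀ T hσ₀ ih =>
    rw [Finset.sum_insert hσ₀, ← ih]
    have e : (fun x => ∑ σ ∈ insert σ₀ T, a σ * g σ x) = a σ₀ • g σ₀ + (1 : ℝ) • fun x => ∑ σ ∈ T, a σ * g σ x := by
      funext x
      simp only [Finset.sum_insert hσ₀, Pi.add_apply, Pi.smul_apply, smul_eq_mul, one_mul]
    rw [e, sahiE_update_lin, one_mul]

variable {ι : Type*} [DecidableEq ι] [Fintype ι]

omit [Fintype ι] in
/-- Cylinder with the pivot removed, in the `if` form of `sahiE_cylinders_edge_ge`. [this work] -/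
theorem ite_insert_erase (τ : Finset ι) (e : ι) : (if decide (e ∈ τ) then insert e (τ.erase e) else τ.erase e) = τ := by
  by_cases h : e ∈ τ
  · simp [h, Finset.insert_erase]
  · simp [h, Finset.erase_eq_of_notMem]

/-- **CONTRACTION ALONG A COORDINATE ON THE CUMULATION CONE, EVERY ORDER.**  `μ = bernoulliWeight q`; slots `f_l = Σ_σ c_l(σ)·1_{C(σ)}` with `c_l ≥ 0`
(Sahi's cone `𝒞`); sections `f_l^e = Σ_σ c_l(σ)·1_{C(σ∖{e})}`.  Then `q_e · E_n(f^e) ≤ E_n(f)` — `E_n(f) ≥ P(e open)·E_n(f | e open)`. [this work] -/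
theorem sahiE_cumulation_edge_ge (q : ι → unitInterval) {n : ℕ} (c : Fin n → Finset ι → ℝ) (hc : ∀ l σ, 0 ≤ c l σ) (e : ι) :
    (q e : ℝ) * sahiE (bernoulliWeight q) n (fun l (ω : Set ι) => ∑ σ, c l σ * ind {ω : Set ι | ((σ.erase e : Finset ι) : Set ι) ⊆ ω} ω) ≤
      sahiE (bernoulliWeight q) n (fun l (ω : Set ι) => ∑ σ, c l σ * ind {ω : Set ι | (σ : Set ι) ⊆ ω} ω) := by
  -- claim for mixed families: cumulation slots on `A`, single cylinders `τ_l` off `A`; induction on `A`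
  suffices h : ∀ (A : Finset (Fin n)) (τ : Fin n → Finset ι),
      (q e : ℝ) * sahiE (bernoulliWeight q) n (fun l (ω : Set ι) =>
          if l ∈ A then ∑ σ, c l σ * ind {ω : Set ι | ((σ.erase e : Finset ι) : Set ι) ⊆ ω} ω
          else ind {ω : Set ι | (((τ l).erase e : Finset ι) : Set ι) ⊆ ω} ω) ≤
        sahiE (bernoulliWeight q) n (fun l (ω : Set ι) =>
          if l ∈ A then ∑ σ, c l σ * ind {ω : Set ι | (σ : Set ι) ⊆ ω} ω else ind {ω : Set ι | ((τ l : Finset ι) : Set ι) ⊆ ω} ω) by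
    have h' := h univ (fun _ => ∅)
    simpa only [Finset.mem_univ, if_true] using h'
  intro A
  induction A using Finset.induction_on with
  | empty =>
    intro τ
    simp only [Finset.notMem_empty, if_false]
    have hV := sahiE_cylinders_edge_ge q (n := n) (fun l => decide (e ∈ τ l)) (σ := fun l => (τ l).erase e) (e := e)
      (fun l => Finset.notMem_erase e (τ l))
    simp only [ite_insert_erase] at hV
    exact hV
  | insert l₀ A hl₀ ih =>
    intro τ
    -- name the two mixed families as updates at slot `l₀` of the families for `A`
    set Ge : Fin n → Set ι → ℝ := fun l ω =>
      if l ∈ A then ∑ σ, c l σ * ind {ω : Set ι | ((σ.erase e : Finset ι) : Set ι) ⊆ ω} ω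
      else ind {ω : Set ι | (((τ l).erase e : Finset ι) : Set ι) ⊆ ω} ω with hGe
    set G : Fin n → Set ι → ℝ := fun l ω =>
      if l ∈ A then ∑ σ, c l σ * ind {ω : Set ι | (σ : Set ι) ⊆ ω} ω else ind {ω : Set ι | ((τ l : Finset ι) : Set ι) ⊆ ω} ω with hG
    have eGe : (fun l (ω : Set ι) =>
          if l ∈ insert l₀ A then ∑ σ, c l σ * ind {ω : Set ι | ((σ.erase e : Finset ι) : Set ι) ⊆ ω} ω
          else ind {ω : Set ι | (((τ l).erase e : Finset ι) : Set ι) ⊆ ω} ω)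
        = update Ge l₀ (fun ω => ∑ σ, c l₀ σ * (fun σ (ω : Set ι) => ind {ω : Set ι | ((σ.erase e : Finset ι) : Set ι) ⊆ ω} ω) σ ω) := by
      funext l ω
      by_cases h : l = l₀
      · subst h; simp
      · rw [update_of_ne h]; simp [hGe, h]
    have eG : (fun l (ω : Set ι) =>
          if l ∈ insert l₀ A then ∑ σ, c l σ * ind {ω : Set ι | (σ : Set ι) ⊆ ω} ω else ind {ω : Set ι | ((τ l : Finset ι) : Set ι) ⊆ ω} ω)
        = update G l₀ (fun ω => ∑ σ, c l₀ σ * (fun σ (ω : Set ι) => ind {ω : Set ι | (σ : Set ι) ⊆ ω} ω) σ ω) := by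
      funext l ω
      by_cases h : l = l₀
      · subst h; simp
      · rw [update_of_ne h]; simp [hG, h]
    rw [eGe, eG, sahiE_update_finset_sum, sahiE_update_finset_sum, Finset.mul_sum]
    refine Finset.sum_le_sum fun σ _ => ?_
    rw [← mul_assoc, mul_comm (q e : ℝ) (c l₀ σ), mul_assoc]
    refine mul_le_mul_of_nonneg_left ?_ (hc l₀ σ)
    -- the updated families are the mixed families for `A` with `τ l₀ := σ`
    have e1 : update Ge l₀ ((fun σ (ω : Set ι) => ind {ω : Set ι | ((σ.erase e : Finset ι) : Set ι) ⊆ ω} ω) σ)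
        = fun l (ω : Set ι) =>
          if l ∈ A then ∑ σ, c l σ * ind {ω : Set ι | ((σ.erase e : Finset ι) : Set ι) ⊆ ω} ω
          else ind {ω : Set ι | (((update τ l₀ σ l).erase e : Finset ι) : Set ι) ⊆ ω} ω := by
      funext l ω
      by_cases h : l = l₀
      · subst h; simp [hl₀]
      · rw [update_of_ne h, update_of_ne h]
    have e2 : update G l₀ ((fun σ (ω : Set ι) => ind {ω : Set ι | (σ : Set ι) ⊆ ω} ω) σ)
        = fun l (ω : Set ι) =>
          if l ∈ A then ∑ σ, c l σ * ind {ω : Set ι | (σ : Set ι) ⊆ ω} ω else ind {ω : Set ι | ((update τ l₀ σ l : Finset ι) : Set ι) ⊆ ω} ω := by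
      funext l ω
      by_cases h : l = l₀
      · subst h; simp [hl₀]
      · rw [update_of_ne h, update_of_ne h]
    rw [e1, e2]
    exact ih (update τ l₀ σ)

omit [Fintype ι] in
/-- Iterated sections: erasing a set `D` of coordinates from every cylinder. [this work] -/
theorem sdiff_insert_eq_erase_sdiff (σ D : Finset ι) (e : ι) : σ \ insert e D = (σ \ D).erase e := by
  ext x; simp only [mem_sdiff, mem_insert, mem_erase]; tauto

/-- **CONTRACTION ALONG A SET OF COORDINATES ON THE CUMULATION CONE**: `(∏_{e∈D} q_e) · E_n(f^D) ≤ E_n(f)`, `f^D(ω) = f(ω ∪ D)`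
(`= Σ_σ c(σ)·1_{C(σ∖D)}`), for cumulation slots, every order. [this work] -/
theorem sahiE_cumulation_edges_ge (q : ι → unitInterval) {n : ℕ} (c : Fin n → Finset ι → ℝ) (hc : ∀ l σ, 0 ≤ c l σ) (D : Finset ι) :
    (∏ e ∈ D, (q e : ℝ)) * sahiE (bernoulliWeight q) n (fun l (ω : Set ι) => ∑ σ, c l σ * ind {ω : Set ι | ((σ \ D : Finset ι) : Set ι) ⊆ ω} ω) ≤
      sahiE (bernoulliWeight q) n (fun l (ω : Set ι) => ∑ σ, c l σ * ind {ω : Set ι | (σ : Set ι) ⊆ ω} ω) := by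
  induction D using Finset.induction_on with
  | empty => simp
  | insert e D he ih =>
    rw [Finset.prod_insert he]
    -- regroup the coefficients of the `D`-sections by their cylinder: `f^D = Σ_ρ c'(ρ) 1_{C(ρ)}` with `c'(ρ) = Σ_{σ : σ∖D = ρ} c(σ)`
    have regroup : ∀ (l : Fin n) (g : Finset ι → Set ι → ℝ) (ω : Set ι),
        ∑ σ, c l σ * g (σ \ D) ω = ∑ ρ, (∑ σ ∈ univ.filter (fun σ => σ \ D = ρ), c l σ) * g ρ ω := by
      intro l g ω
      rw [← Finset.sum_fiberwise_of_maps_to (s := univ) (t := univ) (g := fun σ : Finset ι => σ \ D) (fun σ _ => Finset.mem_univ _)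
        (fun σ => c l σ * g (σ \ D) ω)]
      refine Finset.sum_congr rfl fun ρ _ => ?_
      rw [Finset.sum_mul]
      refine Finset.sum_congr rfl fun σ hσ => ?_
      rw [(Finset.mem_filter.1 hσ).2]
    have hc' : ∀ l ρ, 0 ≤ ∑ σ ∈ univ.filter (fun σ : Finset ι => σ \ D = ρ), c l σ := fun l ρ => Finset.sum_nonneg fun σ _ => hc l σ
    have step := sahiE_cumulation_edge_ge q (n := n) (fun l ρ => ∑ σ ∈ univ.filter (fun σ : Finset ι => σ \ D = ρ), c l σ) hc' e
    have eD : (fun l (ω : Set ι) => ∑ ρ, (∑ σ ∈ univ.filter (fun σ : Finset ι => σ \ D = ρ), c l σ) * ind {ω : Set ι | (ρ : Set ι) ⊆ ω} ω)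
        = fun l (ω : Set ι) => ∑ σ, c l σ * ind {ω : Set ι | ((σ \ D : Finset ι) : Set ι) ⊆ ω} ω := by
      funext l ω; exact (regroup l (fun ρ ω => ind {ω : Set ι | (ρ : Set ι) ⊆ ω} ω) ω).symm
    have eDe : (fun l (ω : Set ι) => ∑ ρ, (∑ σ ∈ univ.filter (fun σ : Finset ι => σ \ D = ρ), c l σ)
          * ind {ω : Set ι | ((ρ.erase e : Finset ι) : Set ι) ⊆ ω} ω)
        = fun l (ω : Set ι) => ∑ σ, c l σ * ind {ω : Set ι | ((σ \ insert e D : Finset ι) : Set ι) ⊆ ω} ω := by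
      funext l ω
      rw [← regroup l (fun ρ ω => ind {ω : Set ι | ((ρ.erase e : Finset ι) : Set ι) ⊆ ω} ω) ω]
      simp only [sdiff_insert_eq_erase_sdiff]
    rw [eD, eDe] at step
    have hqe : 0 ≤ (q e : ℝ) := (q e).2.1
    calc (q e : ℝ) * (∏ x ∈ D, (q x : ℝ)) *
          sahiE (bernoulliWeight q) n (fun l (ω : Set ι) => ∑ σ, c l σ * ind {ω : Set ι | ((σ \ insert e D : Finset ι) : Set ι) ⊆ ω} ω)
        = (∏ x ∈ D, (q x : ℝ)) * ((q e : ℝ) *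
          sahiE (bernoulliWeight q) n (fun l (ω : Set ι) => ∑ σ, c l σ * ind {ω : Set ι | ((σ \ insert e D : Finset ι) : Set ι) ⊆ ω} ω)) := by
          ring
      _ ≤ (∏ x ∈ D, (q x : ℝ)) * sahiE (bernoulliWeight q) n
          (fun l (ω : Set ι) => ∑ σ, c l σ * ind {ω : Set ι | ((σ \ D : Finset ι) : Set ι) ⊆ ω} ω) :=
          mul_le_mul_of_nonneg_left step (Finset.prod_nonneg fun x _ => (q x).2.1)
      _ ≤ _ := ih

end

end Summit.CriticalPhenomena.PercolationContinuityZ3.Theorems.SahiTangentCyl
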